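import Summits.Ventures.PercRepro.RankLevelSetBiIndepPerElem

/-! # RankLevelSetIndepNMP — THE NORMALISED MATCHING PROPERTY OF THE INDEPENDENCE COMPLEX (B-NMP) AND ITS
PRINCIPAL CASE (T), THE MONOTONE MARGINAL OF AN ELEMENT (night-1 g25; dossier §37.4, §37.6)

For a finite matroid `A` let `indepLevel A k` be the independent `k`-sets and `indepLevelCount A k = I_k` their number.

* `IndepNMP A` ((B-NMP), a `Prop`, NOT asserted): for every `k` and every family `𝒮` of independent `k`-sets,
  `#𝒮 · I_{k+1} ≤ #{T ∈ I_{k+1} : T ⊇ some S ∈ 𝒮} · I_k` — the inclusion graph between consecutive levels of the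
  independence complex has the normalised matching property (equivalently, by Hall's theorem, the uniform measures on
  `I_k` and `I_{k+1}` admit a coupling `S ⊆ T`; equivalently every up-set of the complex has nondecreasing density in
  the levels). Census (night-1 g25, own exact max-flow code): every matroid on ≤ 8 elements (8,356 `(M,k)` instances)
  and ALL 383,172 matroids on 9 elements (1,724,274 instances, kit j306116): 0 failures. For matroids whose
  independence polynomial is real stable it is a theorem of the published literature (the truncations of a strongly
  Rayleigh measure are stochastically increasing — Borcea–Brändén–Liggett 2009, quoted from memory).
  **FALSE IN GENERAL** (night-1 g25, dossier §37.8–37.9): the cycle matroid of the theta graph `Θ(1,2,2,2,3)`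
  (two vertices joined by paths of lengths 1, 2, 2, 2, 3; 7 vertices, 10 edges, rank 6) has 168 forests with 5 edges,
  60 of them through the direct edge `z`, and 68 spanning trees, 24 through `z`: the family of the 60 five-edge
  forests through `z` has only the 24 trees through `z` as up-neighbours, and `60 · 68 = 4080 > 24 · 168 = 4032`.
* `ElemMono A` ((T), a `Prop`, NOT asserted): for every element `z` and every `k`, the fraction of independent
  `k`-sets containing `z` is nondecreasing in `k`: `#{S ∈ I_k : z ∈ S} · I_{k+1} ≤ #{S ∈ I_{k+1} : z ∈ S} · I_k`;
  equivalently `I_{k+1}(A ∖ z) · I_{k−1}(A / z) ≤ I_k(A ∖ z) · I_k(A / z)` (the «mixed log-concavity» of the deletion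
  and contraction profiles; for a coloop `z` it is the log-concavity of `I_k(A ∖ z)`, i.e. Mason's conjecture in its
  weak form). Census: every matroid with ≤ 9 elements and 61,517 instances at n ≤ 8: 0 failures. **FALSE IN
  GENERAL**: on `Θ(1,2,2,2,3)` the fraction of forests through the direct edge is `60/168 = 5/14` at 5 edges and
  `24/68 = 6/17` at 6 edges (the spanning trees) — it drops; 23 of 192,000 random matroids on 10 and 11 elements
  fail, always at the top level `k = rank − 1` (dossier §37.8–37.9).
* **`elemMono_of_indepNMP`**: (B-NMP) ⟹ (T) — the family of `k`-sets through `z` has all its up-neighbours through `z`.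
Every declaration has a docstring; imports: the cell's own modules and Mathlib only. Axioms: standard. -/

namespace PercRepro

open Set Matroid

variable {α : Type} (A : Matroid α)

/-- **The independent `k`-sets** of `A`. -/
def indepLevel (k : ℕ) : Set (Set α) := {S : Set α | S ⊆ A.E ∧ S.ncard = k ∧ A.Indep S}

/-- The up-neighbourhood of a family `𝒮` at level `k + 1`: the independent `(k+1)`-sets containing a member. -/
def indepUpNbhd (k : ℕ) (𝒮 : Set (Set α)) : Set (Set α) :=
  {T ∈ indepLevel A (k + 1) | ∃ S ∈ 𝒮, S ⊆ T}

/-- **The independence profile** `I_k = #indepLevel A k`. -/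
noncomputable def indepLevelCount (k : ℕ) : ℕ := (indepLevel A k).ncard

/-- **(B-NMP) — THE NORMALISED MATCHING PROPERTY OF THE INDEPENDENCE COMPLEX** (a `Prop`, NOT asserted, and FALSE
for the theta graph `Θ(1,2,2,2,3)`, dossier §37.8): for every level `k` and every family `𝒮 ⊆ I_k`,
`#𝒮 · I_{k+1} ≤ #(∇𝒮) · I_k`. -/
def IndepNMP : Prop :=
  ∀ (k : ℕ) (𝒮 : Set (Set α)), 𝒮 ⊆ indepLevel A k →
    𝒮.ncard * indepLevelCount A (k + 1) ≤ (indepUpNbhd A k 𝒮).ncard * indepLevelCount A k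

/-- **(T) — THE MONOTONE MARGINAL OF AN ELEMENT** (a `Prop`, NOT asserted, and FALSE for the theta graph
`Θ(1,2,2,2,3)` at its direct edge, dossier §37.8): the fraction of independent `k`-sets containing `z` is
nondecreasing in `k`. -/
def ElemMono : Prop :=
  ∀ z ∈ A.E, ∀ k : ℕ,
    {S ∈ indepLevel A k | z ∈ S}.ncard * indepLevelCount A (k + 1) ≤
      {S ∈ indepLevel A (k + 1) | z ∈ S}.ncard * indepLevelCount A k

variable [A.Finite]

/-- The independent `k`-sets are finitely many. -/
lemma indepLevel_finite (k : ℕ) : (indepLevel A k).Finite :=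
  A.ground_finite.finite_subsets.subset (fun _ h => h.1)

/-- **(B-NMP) ⟹ (T)**: the up-neighbourhood of the `k`-sets through `z` consists of `(k+1)`-sets through `z`. -/
theorem elemMono_of_indepNMP (h : IndepNMP A) : ElemMono A := by
  intro z _ k
  have h1 := h k {S ∈ indepLevel A k | z ∈ S} (fun S hS => hS.1)
  have h2 : (indepUpNbhd A k {S ∈ indepLevel A k | z ∈ S}).ncard ≤ {S ∈ indepLevel A (k + 1) | z ∈ S}.ncard := by
    refine Set.ncard_le_ncard ?_ ((indepLevel_finite A (k + 1)).subset (fun S hS => hS.1))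
    rintro T ⟨hT, S, ⟨-, hzS⟩, hST⟩
    exact ⟨hT, hST hzS⟩
  exact h1.trans (Nat.mul_le_mul_right _ h2)

end PercRepro
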